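import Literature.Analysis.InverseSpectral.KreinStringWeylLimit
import HarnessLib

/-!
# Kreĭn strings: elementary operations and their effect on the Titchmarsh–Weyl function

The two operations generating all Stieltjes strings (finitely many point masses) from the empty
string, and the corresponding transformations of the principal Titchmarsh–Weyl function
(Kac–Kreĭn 1974 §§1–2; these are the steps of Stieltjes' continued fraction
`q = l₀ + 1/(-m₁ z + 1/(l₁ + 1/(-m₂ z + …)))`):

* `principalWeylFunction_of_massMeasure_eq_zero`: the string `S[0, L]` without mass has
  `q ≡ L` (`L < ∞`);
* `principalWeylFunction_add_dirac`: adding a point mass `m₀ > 0` at the left end,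
  `dm' = dm + m₀ δ₀`, transforms `q` into `q/(1 - z m₀ q)`, i.e. `-1/q' = -1/q + m₀ z`
  (the fundamental system becomes `φ' = φ - z m₀ ψ`, `ψ' = ψ`).

## References

KacKrein1974 (§§1–2), DymMcKean1976 (§5.8).
-/

open MeasureTheory Filter Set Topology
open scoped ENNReal

noncomputable section

namespace Literature.Analysis.InverseSpectral

namespace KreinString

/-! ### The string without mass -/

/-- Without mass on `[0, x]` the fundamental system is `φ ≡ 1`, `ψ(x) = x`. [folklore] -/
theorem psi_eq_of_massMeasure_Icc_eq_zero (S : KreinString) (z : ℂ) {x : ℝ} (hx : x ∈ S.dom)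
    (hμ : S.massMeasure (Icc 0 x) = 0) : S.psi z x = x := by
  rw [S.psi_eq_sub_integral z hx]
  have h0 : ∀ t ∈ Icc 0 x, ∫ u in Icc 0 t, S.psi z u ∂S.massMeasure = 0 := fun t ht => by
    have : S.massMeasure (Icc 0 t) = 0 := measure_mono_null (Icc_subset_Icc_right ht.2) hμ
    rw [Measure.restrict_eq_zero.2 this, integral_zero_measure]
  rw [setIntegral_congr_fun measurableSet_Icc h0]
  simp

/-- **The empty string**: for `S[0, L]` with `L < ∞` and no mass at all, `q_S ≡ L`.
[cite: KacKrein1974, §2] -/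
theorem principalWeylFunction_of_massMeasure_eq_zero (S : KreinString) (hL : S.length ≠ ⊤)
    (hμ : S.massMeasure = 0) (z : ℂ) : S.principalWeylFunction z = (S.length.toReal : ℂ) := by
  haveI := S.toEnd_neBot
  have hL0 : 0 < S.length.toReal := ENNReal.toReal_pos S.length_pos.ne' hL
  have hQ : ∀ x ∈ Ioo 0 S.length.toReal, S.psi z x / S.phi z x = x := by
    intro x hx
    have hxd : x ∈ S.dom := ⟨hx.1.le, (ENNReal.ofReal_lt_iff_lt_toReal hx.1.le hL).2 hx.2⟩
    have h0 : S.massMeasure (Icc 0 x) = 0 := by rw [hμ]; rfl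
    rw [S.psi_eq_of_massMeasure_Icc_eq_zero z hxd h0,
      S.phi_eq_one_of_massMeasure_Icc_eq_zero z hxd h0, div_one]
  have ht : Tendsto (fun x => S.psi z x / S.phi z x) S.toEnd (𝓝 (S.length.toReal : ℂ)) := by
    unfold toEnd
    rw [if_neg hL]
    refine Tendsto.congr' ?_ ((Complex.continuous_ofReal.tendsto _).mono_left nhdsWithin_le_nhds)
    exact mem_of_superset (Ioo_mem_nhdsLT hL0) (fun x hx => (hQ x hx).symm)
  exact ht.limUnder_eq

/-! ### Adding a point mass at the left end -/

section AddDirac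

variable {S S' : KreinString} {m₀ : ℝ}

/-- Set integrals against `dm + m₀ δ₀` over `[0, x]`. [folklore] -/
lemma setIntegral_add_dirac
    (hm : S'.massMeasure = S.massMeasure + (ENNReal.ofReal m₀) • Measure.dirac 0)
    (hm₀ : 0 ≤ m₀) {x : ℝ} (hx : x ∈ S.dom) {g : ℝ → ℂ} (hg : ContinuousOn g (Icc 0 x)) :
    ∫ s in Icc 0 x, g s ∂S'.massMeasure =
      (∫ s in Icc 0 x, g s ∂S.massMeasure) + (m₀ : ℂ) * g 0 := by
  have hgi : IntegrableOn g (Icc 0 x) S.massMeasure := S.integrableOn_Icc_of_continuousOn hx hg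
  have hgd : Integrable g ((ENNReal.ofReal m₀) • Measure.dirac (0 : ℝ)) :=
    (integrable_dirac (by simp)).smul_measure ENNReal.ofReal_ne_top
  rw [hm, Measure.restrict_add, integral_add_measure hgi hgd.restrict, Measure.restrict_smul,
    integral_smul_measure, setIntegral_dirac, if_pos (show (0 : ℝ) ∈ Icc 0 x from ⟨le_rfl, hx.1⟩),
    ENNReal.toReal_ofReal hm₀, Complex.real_smul]

/-- The two strings have the same parameter interval. [folklore] -/
lemma dom_eq_of_length_eq (hL : S'.length = S.length) : S'.dom = S.dom := by
  ext x
  simp [KreinString.mem_dom, hL]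

/-- The two strings have the same end filter. [folklore] -/
lemma toEnd_eq_of_length_eq (hL : S'.length = S.length) : S'.toEnd = S.toEnd := by
  unfold toEnd
  rw [hL]

/-- **Adding a point mass at `0`, effect on `φ`**: `φ' = φ - z m₀ ψ` solves the new equation with
data `(1, 0)`. [cite: KacKrein1974, §1] -/
theorem isSolution_add_dirac_phi
    (hm : S'.massMeasure = S.massMeasure + (ENNReal.ofReal m₀) • Measure.dirac 0)
    (hm₀ : 0 ≤ m₀) (hL : S'.length = S.length) (z : ℂ) :
    S'.IsSolution z 1 0 (fun x => S.phi z x - z * m₀ * S.psi z x) := by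
  have hdom := dom_eq_of_length_eq hL
  refine ⟨?_, fun x hx => ?_⟩
  · rw [hdom]
    exact (S.isSolution_phi z).1.sub (continuousOn_const.mul (S.isSolution_psi z).1)
  · rw [hdom] at hx
    have hφc : ContinuousOn (S.phi z) (Icc 0 x) := (S.isSolution_phi z).1.mono (S.Icc_subset_dom hx)
    have hψc : ContinuousOn (S.psi z) (Icc 0 x) := (S.isSolution_psi z).1.mono (S.Icc_subset_dom hx)
    have hk : ContinuousOn (fun s : ℝ => ((x - s : ℝ) : ℂ)) (Icc 0 x) :=
      Complex.continuous_ofReal.comp_continuousOn (continuousOn_const.sub continuousOn_id)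
    have hcont : ContinuousOn (fun s => ((x - s : ℝ) : ℂ) * (S.phi z s - z * m₀ * S.psi z s))
        (Icc 0 x) := hk.mul (hφc.sub (continuousOn_const.mul hψc))
    rw [setIntegral_add_dirac hm hm₀ hx hcont]
    have hφ := (S.isSolution_phi z).2 x hx
    have hψ := (S.isSolution_psi z).2 x hx
    have hsplit :
        ∫ s in Icc 0 x, ((x - s : ℝ) : ℂ) * (S.phi z s - z * m₀ * S.psi z s) ∂S.massMeasure =
          (∫ s in Icc 0 x, ((x - s : ℝ) : ℂ) * S.phi z s ∂S.massMeasure) -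
          z * m₀ * ∫ s in Icc 0 x, ((x - s : ℝ) : ℂ) * S.psi z s ∂S.massMeasure := by
      rw [← integral_const_mul, ← integral_sub (f := fun s => ((x - s : ℝ) : ℂ) * S.phi z s)
        (g := fun s => z * m₀ * (((x - s : ℝ) : ℂ) * S.psi z s))
        (by exact S.integrableOn_Icc_of_continuousOn hx (hk.mul hφc))
        (by exact (S.integrableOn_Icc_of_continuousOn hx (hk.mul hψc)).const_mul _)]
      exact integral_congr_ae (ae_of_all _ fun s => by ring)
    rw [hsplit, S.phi_apply_zero, S.psi_apply_zero]
    simp only [sub_zero, mul_zero]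
    linear_combination hφ - z * (m₀ : ℂ) * hψ

/-- **Adding a point mass at `0`, effect on `ψ`**: `ψ' = ψ` (the mass at `0` does not act on a
solution vanishing at `0`). [cite: KacKrein1974, §1] -/
theorem isSolution_add_dirac_psi
    (hm : S'.massMeasure = S.massMeasure + (ENNReal.ofReal m₀) • Measure.dirac 0)
    (hm₀ : 0 ≤ m₀) (hL : S'.length = S.length) (z : ℂ) :
    S'.IsSolution z 0 1 (S.psi z) := by
  have hdom := dom_eq_of_length_eq hL
  refine ⟨?_, fun x hx => ?_⟩
  · rw [hdom]
    exact (S.isSolution_psi z).1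
  · rw [hdom] at hx
    have hψc : ContinuousOn (S.psi z) (Icc 0 x) := (S.isSolution_psi z).1.mono (S.Icc_subset_dom hx)
    have hk : ContinuousOn (fun s : ℝ => ((x - s : ℝ) : ℂ)) (Icc 0 x) :=
      Complex.continuous_ofReal.comp_continuousOn (continuousOn_const.sub continuousOn_id)
    rw [setIntegral_add_dirac hm hm₀ hx (g := fun s => ((x - s : ℝ) : ℂ) * S.psi z s)
      (by exact hk.mul hψc), S.psi_apply_zero]
    have hψ := (S.isSolution_psi z).2 x hx
    simp only [mul_zero, add_zero]
    exact hψ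

/-- The new string carries the mass `m₀` at `0`, so it is not the free half-line. [folklore] -/
lemma not_isTrivial_of_add_dirac
    (hm : S'.massMeasure = S.massMeasure + (ENNReal.ofReal m₀) • Measure.dirac 0)
    (hm₀ : 0 < m₀) : ¬ S'.IsTrivial := by
  rintro ⟨-, h0⟩
  have h : S'.massMeasure {0} = 0 := by rw [h0]; rfl
  rw [hm, Measure.add_apply, Measure.smul_apply, Measure.dirac_apply_of_mem (mem_singleton 0),
    smul_eq_mul, mul_one] at h
  have := (add_eq_zero.1 h).2
  rw [ENNReal.ofReal_eq_zero] at this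
  linarith

/-- **Adding a point mass at the left end**: if `S' ` is `S` with an extra mass `m₀ > 0` at `0`
(`dm' = dm + m₀ δ₀`, same length) and `S` is not the free half-line, then for `z ∉ [0, ∞)`
`q_{S'}(z) = q_S(z)/(1 - z m₀ q_S(z))` (and the denominator does not vanish), i.e.
`-1/q_{S'} = -1/q_S + m₀ z`: one step of Stieltjes' continued fraction. [cite: KacKrein1974, §2] -/
theorem principalWeylFunction_add_dirac
    (hm : S'.massMeasure = S.massMeasure + (ENNReal.ofReal m₀) • Measure.dirac 0)
    (hm₀ : 0 < m₀) (hL : S'.length = S.length) (hS : ¬ S.IsTrivial) {z : ℂ}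
    (hz : z ∈ offNonnegAxis) :
    1 - z * m₀ * S.principalWeylFunction z ≠ 0 ∧
      S'.principalWeylFunction z =
        S.principalWeylFunction z / (1 - z * m₀ * S.principalWeylFunction z) := by
  haveI := S.toEnd_neBot
  have hdom := dom_eq_of_length_eq hL
  have hS' := not_isTrivial_of_add_dirac hm hm₀
  have hq := S.tendsto_principalWeylFunction hS hz
  have hq' := S'.tendsto_principalWeylFunction hS' hz
  rw [toEnd_eq_of_length_eq hL] at hq'
  -- the fundamental system of `S'`
  have hφ' : EqOn (S'.phi z) (fun x => S.phi z x - z * m₀ * S.psi z x) S.dom := by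
    rw [← hdom]
    exact (S'.isSolution_phi z).eqOn (isSolution_add_dirac_phi hm hm₀.le hL z)
  have hψ' : EqOn (S'.psi z) (S.psi z) S.dom := by
    rw [← hdom]
    exact (S'.isSolution_psi z).eqOn (isSolution_add_dirac_psi hm hm₀.le hL z)
  -- the algebraic relation between the quotients, eventually along the end filter
  have hev : ∀ᶠ x in S.toEnd, S'.psi z x / S'.phi z x * (1 - z * m₀ * (S.psi z x / S.phi z x)) =
      S.psi z x / S.phi z x := by
    filter_upwards [S.Ici_inter_dom_mem_toEnd S.zero_mem_dom] with x hx
    have hφ0 : S.phi z x ≠ 0 := S.phi_ne_zero_of_mem_offNonnegAxis hz hx.1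
    have hφ0' : S.phi z x - z * m₀ * S.psi z x ≠ 0 := by
      have h := S'.phi_ne_zero_of_mem_offNonnegAxis hz (by rw [hdom]; exact hx.1)
      rw [hφ' hx.1] at h
      exact h
    rw [hψ' hx.1, hφ' hx.1]
    show S.psi z x / (S.phi z x - z * m₀ * S.psi z x) * (1 - z * m₀ * (S.psi z x / S.phi z x)) =
      S.psi z x / S.phi z x
    rw [show 1 - z * m₀ * (S.psi z x / S.phi z x) = (S.phi z x - z * m₀ * S.psi z x) / S.phi z x by
      field_simp]
    rw [div_mul_div_comm, mul_comm (S.psi z x) _, mul_div_mul_left _ _ hφ0']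
  have hlim := (hq'.mul (tendsto_const_nhds.sub (hq.const_mul (z * m₀)))).congr' hev
  have hrel : S'.principalWeylFunction z * (1 - z * m₀ * S.principalWeylFunction z) =
      S.principalWeylFunction z := tendsto_nhds_unique hlim hq
  have hne : 1 - z * m₀ * S.principalWeylFunction z ≠ 0 := by
    intro h0
    have hq0 : S.principalWeylFunction z = 0 := by rw [← hrel, h0, mul_zero]
    rw [hq0, mul_zero, sub_zero] at h0
    exact one_ne_zero h0
  exact ⟨hne, (eq_div_iff hne).2 hrel⟩

end AddDirac

end KreinString

end Literature.Analysis.InverseSpectral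

end
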